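import Literature.MathematicalPhysics.QuantumFieldTheory.Federbush1986.LandauModePlaquetteVariables
import Literature.Analysis.FunctionSpaces.FlatTorusProofs
import Mathlib.Analysis.Fourier.Inversion
import Mathlib.Algebra.Order.Field.Pointwise
import Mathlib.Algebra.Module.PointwisePi

/-!
# `Federbush1986.MomentumCellPoisson` — Poisson summation on the momentum cell: the periodisation `Σ_n ȟ(p + 2πn)` sees only `h|_{ℤ⁴}`

statement-level skeleton of published theorems with citation tags; proofs where landed; nothing here is a claim about the Yang–Mills mass gap

## What this file is for

In [Federbush1986PhaseCellI] §3 the plaquette constraints on the continuum field are imposed at the LEVEL-0 LATTICE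
plaquettes only: in momentum space every constraint functional is a lattice sum `Σ_n (…)(p + 2πn)` over the dual
lattice ((3.6)–(3.7) p. 327; [FederbushWilliamson1987PhaseCellII] (1.4) p. 1416, periodic in `p`, (3.1) p. 1417). The
variational argument for the constrained minimiser (I §3 p. 327 «minimizing the continuum action subject to this
constraint», (3.4); the Lagrange-multiplier form of `LandauModeMultipliers`) needs the following classical fact, in the
tree's conventions (`ModeDecay.modeFT`: kernel `e^{+ip·x}`, momentum cell `[0,2π)⁴ = cell`, lattice `2πℤ⁴`,
`shiftR p n = p + 2πn`):

**Poisson summation, uniqueness form** (`perSum_hatE_eq_zero`): if `h : ℝ⁴ → ℂ` is continuous and integrable, its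
transform `ȟ(p) = ∫ e^{ip·y} h(y) d⁴y` has product decay `|ȟ(p)| ≤ C Π_k min(1, p_k⁻²)`, and `h(m) = 0` for every
`m ∈ ℤ⁴`, then `Σ_{n∈ℤ⁴} ȟ(p + 2πn) = 0` for every real `p`.

In the application (`LandauModeWeakEulerLagrange`), `h(y)` is the pairing of a test field `ψ` with the TRANSLATE by
`y` of a level-0 plaquette test function, so `h(m)` (`m ∈ ℤ⁴`) are exactly the level-0 plaquette variables of `ψ`, and
`Σ_n ȟ(p+2πn)` is the lattice sum through which `ψ` enters the first variation of the action at the mode.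

## What is proved (0 `Prop` facts, no `sorry`)

* §1 `perSum G p = Σ'_{n∈ℤ⁴} G(p + 2πn)`; `perSum_shiftR` (periodicity); `HasProductDecay`;
  `min_one_inv_sq_shiftR_le` / `norm_shiftR_le_of_decay` (uniform summable majorant `C·7⁴·u(n + cellIndex p₀)` on
  unit sup-balls, with p04's weights `ModeAnalyticityLatticeSums.u`, II (6.8)); `summable_shiftR_of_decay`,
  `norm_perSum_le` (uniform bound), **`continuous_perSum`**, `integrable_of_decay`.
* §2 `cexp_neg_phase_shiftR`; **`integral_cell_cexp_mul_perSum`**: `∫_cell e^{−ip·m} perSum G = ∫_{ℝ⁴} e^{−ip·m} G`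
  (unfolding, from `LandauModePlaquetteVariables.integral_eq_integral_cell_tsum`).
* §3 `hatE h p = ∫ e^{ip·y} h(y) d⁴y`; `hatE_eq_fourier` (`ȟ(p) = 𝓕h(−p/2π)`), `continuous_hatE`,
  `integrable_fourier_of_integrable_hatE`; **`integral_cexp_neg_mul_hatE`**:
  `∫ e^{−ip·m} ȟ(p) d⁴p = (2π)⁴ h(m)` (Mathlib's `Continuous.fourierInv_fourier_eq`, Stein–Weiss I Cor. 1.21).
* §4 `iocCell`; **`eq_zero_of_periodic_of_coeff_zero`**: a continuous `2πℤ⁴`-periodic function on `ℝ⁴` with all cell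
  Fourier coefficients zero vanishes identically — via the tree's flat torus (`Literature.Analysis.FunctionSpaces.Torus.descend`,
  `lift_descend_holds`, `continuous_lift_iff`) and Mathlib's `UnitAddTorus.mFourierCoeff_eq_integral`,
  `hasSum_mFourier_series_apply_of_summable` (Stein–Weiss VII Thm 1.7(ii), Cor. 1.8), after rescaling `p = 2πx`.
* §5 **`perSum_hatE_eq_zero`** (Stein–Weiss VII §2 Thm 2.4 with the roles of `f`, `f̂` exchanged).
* §6 (v1.1, r17 gen 12) **ERRATUM** on the majorant of `HasProductDecay` (Lean `1/0 = 0` makes `min(1, 1/p_k²)` vanish on the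
  coordinate hyperplanes, so the v1 hypothesis forces `G = 0` there: `HasProductDecay.eq_zero_of_apply_eq_zero`) and the
  USABLE class **`HasInvSqDecay G C := ∀ p, ‖G p‖ ≤ C Π_k (1 + p_k²)⁻¹`** with the whole chain re-proved for it
  (`HasInvSqDecay.of_isotropic/mul_bounded/add/sum/norm_shiftR_le/summable_shiftR/norm_perSum_le/continuous_perSum/integrable`,
  **`perSum_hatE_eq_zero_of_invSqDecay`**) — the form the sequel `LandauModeWeakEulerLagrange` consumes.

## Directness

The sources are cited for the STATEMENTS they print: Stein–Weiss, *Introduction to Fourier Analysis on Euclidean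
Spaces*, Ch. I Cor. 1.21 (inversion for `f, f̂ ∈ L¹`), Ch. VII Thm 1.7(ii)/Cor. 1.8 (uniqueness of multiple Fourier
coefficients), Ch. VII §2 Thm 2.4 (Poisson summation: the periodisation of `f ∈ L¹(Eₙ)` has Fourier coefficients
`f̂(m)`); [Federbush1986PhaseCellI] (3.6)–(3.7), (3.12) and [FederbushWilliamson1987PhaseCellII] (1.4), (3.1), (6.8) for
the lattice-sum / momentum-cell / decay conventions. The proofs are ours (Mathlib's inversion theorem and multiple
Fourier series on `UnitAddTorus`).
-/

namespace Literature.MathematicalPhysics.QuantumFieldTheory.Federbush1986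

noncomputable section

open Complex ModeAnalyticity Filter Topology MeasureTheory Set Literature.Analysis.FunctionSpaces
open scoped BigOperators ComplexConjugate FourierTransform RealInnerProductSpace Pointwise

namespace PlaquetteGram

open ModeDecay (toC)
open ModeAnalyticityLatticeSums (b u summable_u b_zero b_of_ne b_nonneg u_nonneg)

/-! ## §1 Periodisation over `2πℤ⁴` of a function with product decay -/

/-- The periodisation `Σ_{n∈ℤ⁴} G(p + 2πn)` (the `Σ_n … (p + 2πn)` of I (3.6)–(3.7), II (1.4)). [cite: Federbush1986PhaseCellI, (3.6)–(3.7) p. 327; FederbushWilliamson1987PhaseCellII, (1.4) p. 1416] -/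
def perSum (G : (Fin 4 → ℝ) → ℂ) (p : Fin 4 → ℝ) : ℂ := ∑' n : Fin 4 → ℤ, G (shiftR p n)

/-- The periodisation is `2π`-periodic (re-indexing `ℤ⁴`). [cite: FederbushWilliamson1987PhaseCellII, (3.1) p. 1417] -/
theorem perSum_shiftR (G : (Fin 4 → ℝ) → ℂ) (p : Fin 4 → ℝ) (m : Fin 4 → ℤ) :
    perSum G (shiftR p m) = perSum G p := by
  unfold perSum
  simp_rw [shiftR_shiftR]
  exact (Equiv.addLeft m).tsum_eq fun n => G (shiftR p n)

/-- Product decay `|G(p)| ≤ C Π_k min(1, 1/p_k²)` (what a rapidly decreasing `ψ̌` times a bounded factor satisfies).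
[cite: FederbushWilliamson1987PhaseCellII, (6.8) p. 1418] -/
def HasProductDecay (G : (Fin 4 → ℝ) → ℂ) (C : ℝ) : Prop :=
  ∀ p, ‖G p‖ ≤ C * ∏ k, min 1 (1 / (p k) ^ 2)

/-- On the unit sup-ball about `p₀`, `min(1, 1/(p_k + 2πn_k)²) ≤ 7·b(n_k + cellIndex p₀ k)` (p04's summable weight `b`).
[cite: FederbushWilliamson1987PhaseCellII, (6.8) p. 1418] -/
theorem min_one_inv_sq_shiftR_le {p₀ p : Fin 4 → ℝ} (hp : ∀ k, |p k - p₀ k| < 1) (n : Fin 4 → ℤ) (k : Fin 4) :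
    min 1 (1 / (shiftR p n k) ^ 2) ≤ 7 * b (n k + cellIndex p₀ k) := by
  set N : ℤ := n k + cellIndex p₀ k with hN
  rcases eq_or_ne N 0 with h0 | h0
  · rw [h0, b_zero]; exact (min_le_left _ _).trans (by norm_num)
  · rw [b_of_ne h0]
    have hq : shiftR p n k = reduced p₀ k + (p k - p₀ k) + 2 * Real.pi * (N : ℝ) := by
      simp only [shiftR, reduced, hN, Int.cast_add]; ring
    have hr : |reduced p₀ k| ≤ Real.pi := abs_reduced_le p₀ k
    have hN1 : (1 : ℝ) ≤ |(N : ℝ)| := by rw [← Int.cast_abs]; exact_mod_cast Int.one_le_abs h0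
    have hπ1 : 2 < Real.pi - 1 := by linarith [Real.pi_gt_three]
    -- |q| ≥ 2π|N| − π − 1 ≥ (π − 1)|N| > 0
    have hq_ge : (Real.pi - 1) * |(N : ℝ)| ≤ |shiftR p n k| := by
      rw [hq]
      have h1 : |2 * Real.pi * (N : ℝ)| = 2 * Real.pi * |(N : ℝ)| := by
        rw [abs_mul, abs_of_pos (by positivity)]
      have h2 : |reduced p₀ k + (p k - p₀ k)| ≤ Real.pi + 1 := by
        calc _ ≤ |reduced p₀ k| + |p k - p₀ k| := abs_add_le _ _
          _ ≤ Real.pi + 1 := by linarith [(hp k).le]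
      have h3 := abs_sub_abs_le_abs_sub (2 * Real.pi * (N : ℝ)) (-(reduced p₀ k + (p k - p₀ k)))
      rw [sub_neg_eq_add, abs_neg, h1] at h3
      have h4 : reduced p₀ k + (p k - p₀ k) + 2 * Real.pi * (N : ℝ)
          = 2 * Real.pi * (N : ℝ) + (reduced p₀ k + (p k - p₀ k)) := by ring
      rw [h4]
      nlinarith
    have hden : 0 < ((Real.pi - 1) * |(N : ℝ)|) ^ 2 := by
      have : 0 < (Real.pi - 1) * |(N : ℝ)| := mul_pos (by linarith) (by linarith)
      positivity
    have hN2 : 0 < (25 : ℝ) * (N : ℝ) ^ 2 := by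
      have : (N : ℝ) ≠ 0 := Int.cast_ne_zero.mpr h0
      positivity
    calc min 1 (1 / shiftR p n k ^ 2) ≤ 1 / shiftR p n k ^ 2 := min_le_right _ _
      _ ≤ 1 / ((Real.pi - 1) * |(N : ℝ)|) ^ 2 := by
          rw [← sq_abs (shiftR p n k)]
          exact one_div_le_one_div_of_le hden (pow_le_pow_left₀ (by nlinarith) hq_ge 2)
      _ ≤ 7 * (1 / (25 * (N : ℝ) ^ 2)) := by
          rw [mul_one_div, div_le_div_iff₀ hden hN2, mul_pow, sq_abs]
          have h4 : 4 ≤ (Real.pi - 1) ^ 2 := by nlinarith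
          nlinarith [sq_nonneg (N : ℝ), mul_le_mul_of_nonneg_right h4 (sq_nonneg (N : ℝ))]

/-- On the unit sup-ball about `p₀` the terms of the periodisation have the summable majorant `C·7⁴·u(n + cellIndex p₀)`.
[cite: FederbushWilliamson1987PhaseCellII, (6.8) p. 1418] -/
theorem norm_shiftR_le_of_decay {G : (Fin 4 → ℝ) → ℂ} {C : ℝ} (hG : HasProductDecay G C) (hC : 0 ≤ C)
    {p₀ p : Fin 4 → ℝ} (hp : ∀ k, |p k - p₀ k| < 1) (n : Fin 4 → ℤ) :
    ‖G (shiftR p n)‖ ≤ C * 7 ^ 4 * u (n + cellIndex p₀) := by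
  refine (hG _).trans ?_
  have h : ∏ k, min 1 (1 / (shiftR p n k) ^ 2) ≤ ∏ k, 7 * b (n k + cellIndex p₀ k) :=
    Finset.prod_le_prod (fun k _ => le_min zero_le_one (by positivity)) fun k _ => min_one_inv_sq_shiftR_le hp n k
  rw [Finset.prod_mul_distrib, Finset.prod_const, Finset.card_univ, Fintype.card_fin] at h
  calc C * ∏ k, min 1 (1 / shiftR p n k ^ 2) ≤ C * (7 ^ 4 * ∏ k, b (n k + cellIndex p₀ k)) :=
        mul_le_mul_of_nonneg_left h hC
    _ = C * 7 ^ 4 * u (n + cellIndex p₀) := by simp only [u, Pi.add_apply]; ring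

/-- The shifted weight family is summable. [cite: FederbushWilliamson1987PhaseCellII, (6.8) p. 1418] -/
theorem summable_u_shift (c : Fin 4 → ℤ) : Summable fun n : Fin 4 → ℤ => u (n + c) :=
  (summable_u.comp_injective (add_left_injective c) : Summable (u ∘ fun n => n + c))

/-- The periodisation of a function with product decay converges absolutely at every point.
[cite: FederbushWilliamson1987PhaseCellII, (1.4) p. 1416, (6.8) p. 1418] -/
theorem summable_shiftR_of_decay {G : (Fin 4 → ℝ) → ℂ} {C : ℝ} (hG : HasProductDecay G C) (hC : 0 ≤ C) (p : Fin 4 → ℝ) :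
    Summable fun n : Fin 4 → ℤ => G (shiftR p n) :=
  Summable.of_norm_bounded ((summable_u_shift (cellIndex p)).mul_left (C * 7 ^ 4))
    (fun n => norm_shiftR_le_of_decay hG hC (p₀ := p) (fun k => by simp) n)

/-- The periodisation of a function with product decay is bounded, uniformly.
[cite: FederbushWilliamson1987PhaseCellII, (1.4) p. 1416, (6.8) p. 1418] -/
theorem norm_perSum_le {G : (Fin 4 → ℝ) → ℂ} {C : ℝ} (hG : HasProductDecay G C) (hC : 0 ≤ C) (p : Fin 4 → ℝ) :
    ‖perSum G p‖ ≤ C * 7 ^ 4 * ∑' n, u n := by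
  unfold perSum
  refine (norm_tsum_le_tsum_norm (summable_shiftR_of_decay hG hC p).norm).trans ?_
  calc ∑' n, ‖G (shiftR p n)‖ ≤ ∑' n, C * 7 ^ 4 * u (n + cellIndex p) :=
        (summable_shiftR_of_decay hG hC p).norm.tsum_le_tsum
          (fun n => norm_shiftR_le_of_decay hG hC (p₀ := p) (fun k => by simp) n)
          ((summable_u_shift (cellIndex p)).mul_left _)
    _ = C * 7 ^ 4 * ∑' n, u n := by
        rw [tsum_mul_left]
        congr 1
        exact (Equiv.addRight (cellIndex p)).tsum_eq u

/-- **The periodisation of a continuous function with product decay is continuous** (uniform convergence on unit balls).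
[cite: FederbushWilliamson1987PhaseCellII, (1.4) p. 1416, (3.1) p. 1417] -/
theorem continuous_perSum {G : (Fin 4 → ℝ) → ℂ} {C : ℝ} (hG : HasProductDecay G C) (hC : 0 ≤ C) (hcont : Continuous G) :
    Continuous (perSum G) := by
  rw [continuous_iff_continuousAt]
  intro p₀
  have hball : ∀ p ∈ Metric.ball p₀ 1, ∀ k, |p k - p₀ k| < 1 := by
    intro p hp k
    have := (dist_pi_lt_iff one_pos).mp (Metric.mem_ball.mp hp) k
    rwa [Real.dist_eq] at this
  have hon : ContinuousOn (perSum G) (Metric.ball p₀ 1) := by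
    unfold perSum
    refine continuousOn_tsum (fun n => ?_) ((summable_u_shift (cellIndex p₀)).mul_left (C * 7 ^ 4))
      (fun n p hp => norm_shiftR_le_of_decay hG hC (hball p hp) n)
    have : Continuous fun p : Fin 4 → ℝ => shiftR p n :=
      continuous_pi fun k => (continuous_apply k).add continuous_const
    exact (hcont.comp this).continuousOn
  exact hon.continuousAt (Metric.isOpen_ball.mem_nhds (Metric.mem_ball_self one_pos))

/-- A function with product decay is integrable on `ℝ⁴` (given measurability): majorant `C Π_k 2/(1 + p_k²)`.
[cite: FederbushWilliamson1987PhaseCellII, (6.8) p. 1418] -/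
theorem integrable_of_decay {G : (Fin 4 → ℝ) → ℂ} {C : ℝ} (hG : HasProductDecay G C) (hC : 0 ≤ C)
    (hmeas : AEStronglyMeasurable G volume) : Integrable G := by
  have h1 : Integrable (fun t : ℝ => (2 : ℝ) * (1 + t ^ 2)⁻¹) := integrable_inv_one_add_sq.const_mul 2
  have hprod : Integrable (fun p : Fin 4 → ℝ => ∏ k, (2 : ℝ) * (1 + (p k) ^ 2)⁻¹) := by
    have := Integrable.fintype_prod (ι := Fin 4) (μ := fun _ => (volume : Measure ℝ)) (fun _ => h1)
    rwa [← MeasureTheory.volume_pi] at this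
  refine Integrable.mono' (hprod.const_mul C) hmeas (ae_of_all _ fun p => (hG p).trans ?_)
  refine mul_le_mul_of_nonneg_left (Finset.prod_le_prod (fun k _ => le_min zero_le_one (by positivity))
    fun k _ => ?_) hC
  -- `min(1, 1/t²) ≤ 2/(1+t²)`
  have ht : 0 < 1 + p k ^ 2 := by positivity
  rcases le_or_gt (p k ^ 2) 1 with h | h
  · refine (min_le_left _ _).trans ?_
    rw [← div_eq_mul_inv, le_div_iff₀ ht]; linarith
  · refine (min_le_right _ _).trans ?_
    rw [← div_eq_mul_inv, div_le_div_iff₀ (by positivity) ht]; linarith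

/-! ## §2 The Fourier coefficients of a periodisation are the Fourier integrals of the function -/

/-- `e^{−i(p + 2πn)·m} = e^{−ip·m}` for `m ∈ ℤ⁴`. [cite: FederbushWilliamson1987PhaseCellII, (3.1) p. 1417] -/
theorem cexp_neg_phase_shiftR (p : Fin 4 → ℝ) (n m : Fin 4 → ℤ) :
    cexp (-I * ∑ k, ((shiftR p n k : ℝ) : ℂ) * (m k : ℂ)) = cexp (-I * ∑ k, (p k : ℂ) * (m k : ℂ)) := by
  have hsum : ∑ k, ((shiftR p n k : ℝ) : ℂ) * (m k : ℂ)
      = ∑ k, (p k : ℂ) * (m k : ℂ) + 2 * Real.pi * ∑ k, (n k : ℂ) * (m k : ℂ) := by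
    simp only [shiftR]
    push_cast
    rw [Finset.mul_sum, ← Finset.sum_add_distrib]
    exact Finset.sum_congr rfl fun k _ => by ring
  have : -I * ∑ k, ((shiftR p n k : ℝ) : ℂ) * (m k : ℂ) = -I * ∑ k, (p k : ℂ) * (m k : ℂ)
      + ((-(∑ k, n k * m k) : ℤ) : ℂ) * (2 * Real.pi * I) := by
    rw [hsum]; push_cast; ring
  rw [this, Complex.exp_add, Complex.exp_int_mul_two_pi_mul_I, mul_one]

/-- **Unfolding: the `m`-th Fourier coefficient of the periodisation over the cell is the Fourier integral of `G` over
`ℝ⁴` at the lattice point `m`**: `∫_cell e^{−ip·m} Σ_n G(p+2πn) d⁴p = ∫_{ℝ⁴} e^{−ip·m} G(p) d⁴p` (integrable `G`).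
[cite: SteinWeiss1971, Ch. VII §2 Thm 2.4; Federbush1986PhaseCellI, (3.6)–(3.7) p. 327; FederbushWilliamson1987PhaseCellII, (1.4) p. 1416] -/
theorem integral_cell_cexp_mul_perSum {G : (Fin 4 → ℝ) → ℂ} (hG : Integrable G) (m : Fin 4 → ℤ) :
    ∫ p in cell, cexp (-I * ∑ k, (p k : ℂ) * (m k : ℂ)) * perSum G p
      = ∫ p, cexp (-I * ∑ k, (p k : ℂ) * (m k : ℂ)) * G p := by
  have hH : Integrable fun p : Fin 4 → ℝ => cexp (-I * ∑ k, (p k : ℂ) * (m k : ℂ)) * G p := by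
    refine hG.bdd_mul (c := 1) (Continuous.aestronglyMeasurable (by fun_prop)) (ae_of_all _ fun p => ?_)
    have : -I * ∑ k, (p k : ℂ) * (m k : ℂ) = ((-(∑ k, p k * (m k : ℝ)) : ℝ) : ℂ) * I := by push_cast; ring
    rw [this, Complex.norm_exp_ofReal_mul_I]
  rw [integral_eq_integral_cell_tsum hH]
  refine setIntegral_congr_fun (MeasurableSet.univ_pi fun _ => measurableSet_Ico) fun p _ => ?_
  simp only [perSum]
  rw [← tsum_mul_left]
  exact tsum_congr fun n => by rw [cexp_neg_phase_shiftR]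

/-! ## §3 Fourier inversion at the lattice points: `∫ e^{−ip·m} ȟ(p) d⁴p = (2π)⁴ h(m)` -/

/-- `⟪v, w⟫ = Σ_k v_k w_k` on `ℝ⁴`. [folklore] -/
private theorem inner_E4 (v w : E4) : ⟪v, w⟫ = ∑ k, v k * w k := by
  rw [PiLp.inner_apply]; simp [mul_comm]

/-- `ℝ⁴` (momenta as plain functions) → the Euclidean space of positions/momenta. [cite: Federbush1986PhaseCellI, (3.12) p. 328] -/
abbrev toE4 (p : Fin 4 → ℝ) : E4 := WithLp.toLp 2 p

/-- The transform `ȟ(p) = ∫ e^{ip·y} h(y) d⁴y` of a position-space function (the sign convention of `ModeDecay.modeFT`,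
I (3.12)). [cite: Federbush1986PhaseCellI, (3.12) p. 328] -/
def hatE (h : E4 → ℂ) (p : Fin 4 → ℝ) : ℂ := ∫ y : E4, cexp (I * ∑ k, (p k : ℂ) * ((y k : ℝ) : ℂ)) * h y

/-- `ȟ(p) = 𝓕h(−p/2π)` (Mathlib's `𝓕` carries the kernel `e^{−2πi⟨v,w⟩}`). [cite: Federbush1986PhaseCellI, (3.12) p. 328] -/
theorem hatE_eq_fourier (h : E4 → ℂ) (p : Fin 4 → ℝ) :
    hatE h p = 𝓕 h ((-(1 / (2 * Real.pi)) : ℝ) • toE4 p) := by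
  rw [Real.fourier_eq']
  unfold hatE
  refine integral_congr_ae (ae_of_all _ fun y => ?_)
  dsimp only
  rw [smul_eq_mul, inner_E4]
  congr 2
  simp only [PiLp.smul_apply, smul_eq_mul]
  push_cast
  rw [Finset.mul_sum, Finset.mul_sum, Finset.sum_mul]
  refine Finset.sum_congr rfl fun k _ => ?_
  field_simp

/-- `ȟ` is continuous for integrable `h`. [cite: Federbush1986PhaseCellI, (3.12) p. 328] -/
theorem continuous_hatE {h : E4 → ℂ} (hint : Integrable h) : Continuous (hatE h) := by
  have hc : Continuous (𝓕 h) :=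
    VectorFourier.fourierIntegral_continuous Real.continuous_fourierChar (innerSL ℝ).continuous₂ hint
  have : hatE h = fun p => 𝓕 h ((-(1 / (2 * Real.pi)) : ℝ) • toE4 p) := funext (hatE_eq_fourier h)
  rw [this]
  have hl : Continuous fun p : Fin 4 → ℝ => (-(1 / (2 * Real.pi)) : ℝ) • toE4 p :=
    (PiLp.continuous_toLp 2 (fun _ : Fin 4 => ℝ)).const_smul (-(1 / (2 * Real.pi)) : ℝ)
  exact hc.comp hl

/-- Change of variables `p ↦ c·p ∈ ℝ⁴ = E4`: `∫ F(c·p) d⁴p = |c|⁻⁴ ∫_{E4} F`. [folklore] -/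
private theorem integral_comp_smul_toE4 (F : E4 → ℂ) (c : ℝ) :
    ∫ p : Fin 4 → ℝ, F (c • toE4 p) = |(c ^ 4)⁻¹| * ∫ w : E4, F w := by
  have h1 : ∫ p : Fin 4 → ℝ, F (c • toE4 p) = ∫ w : E4, F (c • w) := by
    rw [← (PiLp.volume_preserving_toLp (Fin 4)).integral_comp (MeasurableEquiv.toLp 2 (Fin 4 → ℝ)).measurableEmbedding]
  rw [h1, Measure.integral_comp_smul volume F c]
  simp [finrank_euclideanSpace]

/-- `ȟ` is integrable on `ℝ⁴` iff `𝓕h` is integrable on `E4` (linear change of variables). [cite: Federbush1986PhaseCellI, (3.12) p. 328] -/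
theorem integrable_fourier_of_integrable_hatE {h : E4 → ℂ} (hF : Integrable (hatE h)) : Integrable (𝓕 h) := by
  have hc0 : (-(1 / (2 * Real.pi)) : ℝ) ≠ 0 := neg_ne_zero.mpr (by positivity)
  have h1 : hatE h = (fun w : E4 => 𝓕 h ((-(1 / (2 * Real.pi)) : ℝ) • w)) ∘ (WithLp.toLp 2 : (Fin 4 → ℝ) → E4) := by
    funext p; simp only [Function.comp_apply, hatE_eq_fourier]
  rw [h1, (PiLp.volume_preserving_toLp (Fin 4)).integrable_comp_emb
    (MeasurableEquiv.toLp 2 (Fin 4 → ℝ)).measurableEmbedding] at hF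
  exact (integrable_comp_smul_iff volume (𝓕 h) hc0).mp hF

/-- **Fourier inversion at the lattice points**: for continuous integrable `h` on `ℝ⁴` with integrable transform,
`∫ e^{−ip·m} ȟ(p) d⁴p = (2π)⁴ h(m)` for `m ∈ ℤ⁴` (Mathlib's `Continuous.fourierInv_fourier_eq` in the `e^{ip·y}`
normalisation). [cite: SteinWeiss1971, Ch. I Cor. 1.21; Federbush1986PhaseCellI, (3.6)–(3.7) p. 327] -/
theorem integral_cexp_neg_mul_hatE {h : E4 → ℂ} (hcont : Continuous h) (hint : Integrable h)
    (hF : Integrable (𝓕 h)) (m : Fin 4 → ℤ) :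
    ∫ p : Fin 4 → ℝ, cexp (-I * ∑ k, (p k : ℂ) * (m k : ℂ)) * hatE h p
      = (2 * Real.pi) ^ 4 * h (toE4 fun k => (m k : ℝ)) := by
  set mE : E4 := toE4 fun k => (m k : ℝ) with hmE
  set Φ : E4 → ℂ := fun w => cexp (↑(2 * Real.pi * ⟪w, mE⟫) * I) * 𝓕 h w with hΦ
  have hint_eq : ∀ p : Fin 4 → ℝ, cexp (-I * ∑ k, (p k : ℂ) * (m k : ℂ)) * hatE h p
      = Φ ((-(1 / (2 * Real.pi)) : ℝ) • toE4 p) := by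
    intro p
    rw [hΦ, hatE_eq_fourier]
    dsimp only
    congr 2
    rw [inner_E4]
    simp only [PiLp.smul_apply, smul_eq_mul, hmE]
    push_cast
    rw [Finset.mul_sum, Finset.mul_sum, Finset.sum_mul]
    refine Finset.sum_congr rfl fun k _ => ?_
    field_simp
  simp_rw [hint_eq]
  rw [integral_comp_smul_toE4 Φ]
  have hinv : ∫ w : E4, Φ w = h mE := by
    have := congr_fun (hcont.fourierInv_fourier_eq hint hF) mE
    rw [Real.fourierInv_eq'] at this
    simpa [hΦ, smul_eq_mul] using this
  rw [hinv]
  congr 1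
  rw [show (-(1 / (2 * Real.pi))) ^ 4 = ((2 * Real.pi) ^ 4)⁻¹ by ring, inv_inv, abs_of_pos (by positivity)]
  push_cast
  ring

/-! ## §4 Uniqueness: a continuous `2π`-periodic function with vanishing cell Fourier coefficients vanishes -/

/-- The `Ioc` form of the momentum cell, `∏_k (0, 2π]` (differs from `cell` by a null set). [cite: FederbushWilliamson1987PhaseCellII, (3.1) p. 1417] -/
def iocCell : Set (Fin 4 → ℝ) := Set.univ.pi fun _ => Ioc 0 (2 * Real.pi)

/-- `iocCell` and `cell` agree almost everywhere. [folklore] -/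
private theorem iocCell_ae_eq_cell : (iocCell : Set (Fin 4 → ℝ)) =ᵐ[volume] cell := by
  have h1 : (iocCell : Set (Fin 4 → ℝ)) =ᵐ[volume] Set.Icc (fun _ => (0 : ℝ)) (fun _ => 2 * Real.pi) := by
    rw [MeasureTheory.volume_pi]; exact Measure.univ_pi_Ioc_ae_eq_Icc
  have h2 : (cell : Set (Fin 4 → ℝ)) =ᵐ[volume] Set.Icc (fun _ => (0 : ℝ)) (fun _ => 2 * Real.pi) := by
    rw [MeasureTheory.volume_pi]; exact Measure.univ_pi_Ico_ae_eq_Icc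
  exact h1.trans h2.symm

/-- **Uniqueness of Fourier coefficients on the momentum torus `ℝ⁴/2πℤ⁴`**: a continuous function, `2π`-periodic in
each coordinate, all of whose Fourier coefficients `∫_cell e^{−ip·m} K(p) d⁴p` (`m ∈ ℤ⁴`) vanish, is identically zero
(via the tree's flat torus `Literature.Analysis.FunctionSpaces.Torus.descend` and Mathlib's
`UnitAddTorus.hasSum_mFourier_series_apply_of_summable`). [cite: SteinWeiss1971, Ch. VII §1 Thm 1.7(ii), Cor. 1.8; FederbushWilliamson1987PhaseCellII, (3.1) p. 1417] -/
theorem eq_zero_of_periodic_of_coeff_zero {K : (Fin 4 → ℝ) → ℂ} (hcont : Continuous K)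
    (hper : ∀ (p : Fin 4 → ℝ) (n : Fin 4 → ℤ), K (shiftR p n) = K p)
    (hcoef : ∀ m : Fin 4 → ℤ, ∫ p in cell, cexp (-I * ∑ k, (p k : ℂ) * (m k : ℂ)) * K p = 0) :
    ∀ p, K p = 0 := by
  have h2π : 0 < 2 * Real.pi := Real.two_pi_pos
  have hper' : ∀ (p : Fin 4 → ℝ) (j : Fin 4), K (p + Pi.single j (2 * Real.pi)) = K p := by
    intro p j
    have : p + Pi.single j (2 * Real.pi) = shiftR p (Pi.single j 1) := by
      funext k; simp only [Pi.add_apply, shiftR, Pi.single_apply]; split_ifs <;> simp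
    rw [this, hper]
  have hcoef' : ∀ m : Fin 4 → ℤ, ∫ p in iocCell, cexp (-I * ∑ k, (p k : ℂ) * (m k : ℂ)) * K p = 0 := fun m => by
    rw [setIntegral_congr_set iocCell_ae_eq_cell]; exact hcoef m
  -- the rescaled function on `EuclideanSpace ℝ (Fin 4)`, `1`-periodic
  set g : EuclideanSpace ℝ (Fin 4) → ℂ := fun y => K (fun k => 2 * Real.pi * y k) with hg_def
  have hgc : Continuous g :=
    hcont.comp (continuous_pi fun k => continuous_const.mul ((continuous_apply k).comp (PiLp.continuous_ofLp 2 _)))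
  have hg : Torus.IsLatticePeriodic g := by
    intro j y
    simp only [hg_def]
    have : (fun k => 2 * Real.pi * (y + EuclideanSpace.single j (1 : ℝ)) k)
        = (fun k => 2 * Real.pi * y k) + Pi.single j (2 * Real.pi) := by
      funext k
      simp only [PiLp.add_apply, PiLp.single_apply, Pi.add_apply, Pi.single_apply]
      split_ifs <;> ring
    rw [this, hper']
  have hcd : Continuous (Torus.descend g hg) :=
    Torus.continuous_lift_iff.mp (by rw [Torus.lift_descend_holds g hg]; exact hgc)
  set f : C(UnitAddTorus (Fin 4), ℂ) := ⟨Torus.descend g hg, hcd⟩ with hf_def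
  have hf_mk : ∀ x : Fin 4 → ℝ, f (fun i => (x i : UnitAddCircle)) = K (fun k => 2 * Real.pi * x k) := by
    intro x
    have h1 : (fun i => ((x i : ℝ) : UnitAddCircle)) = Torus.proj (WithLp.toLp 2 x) := (Torus.proj_toLp x).symm
    rw [h1]
    show Torus.lift (Torus.descend g hg) (WithLp.toLp 2 x) = _
    rw [Torus.lift_descend_holds g hg]
  have hmF : ∀ (m : Fin 4 → ℤ) (x : Fin 4 → ℝ), UnitAddTorus.mFourier (-m) (fun i => (x i : UnitAddCircle))
      = cexp (-I * ∑ k, ((2 * Real.pi * x k : ℝ) : ℂ) * (m k : ℂ)) := by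
    intro m x
    simp only [UnitAddTorus.mFourier, ContinuousMap.coe_mk, Pi.neg_apply, fourier_coe_apply]
    rw [← Complex.exp_sum]
    congr 1
    push_cast
    rw [Finset.mul_sum]
    refine Finset.sum_congr rfl fun k _ => ?_
    field_simp
  -- all Fourier coefficients of `f` vanish
  have hcoefT : ∀ m, UnitAddTorus.mFourierCoeff f m = 0 := by
    intro m
    rw [UnitAddTorus.mFourierCoeff_eq_integral f m (fun _ => 0)]
    have hset : {x : Fin 4 → ℝ | ∀ i, x i ∈ Ioc ((fun _ => (0 : ℝ)) i) ((fun _ => (0 : ℝ)) i + 1)}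
        = Set.univ.pi fun _ => Ioc (0 : ℝ) 1 := by ext x; simp
    rw [hset]
    simp_rw [smul_eq_mul, hf_mk, hmF]
    have hsc := Measure.setIntegral_comp_smul_of_pos volume
      (fun p : Fin 4 → ℝ => cexp (-I * ∑ k, (p k : ℂ) * (m k : ℂ)) * K p)
      (Set.univ.pi fun _ => Ioc (0 : ℝ) 1) h2π
    have hfun : (fun x : Fin 4 → ℝ => cexp (-I * ∑ k, ((2 * Real.pi * x k : ℝ) : ℂ) * (m k : ℂ)) * K (fun k => 2 * Real.pi * x k))
        = fun x => (fun p : Fin 4 → ℝ => cexp (-I * ∑ k, (p k : ℂ) * (m k : ℂ)) * K p) ((2 * Real.pi) • x) := by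
      funext x; rfl
    rw [hfun, hsc]
    have hS : (2 * Real.pi) • (Set.univ.pi fun _ : Fin 4 => Ioc (0 : ℝ) 1) = iocCell := by
      rw [smul_univ_pi, iocCell]
      congr 1; funext i
      show (2 * Real.pi) • Ioc (0 : ℝ) 1 = Ioc 0 (2 * Real.pi)
      rw [LinearOrderedField.smul_Ioc h2π, mul_zero, mul_one]
    rw [hS, hcoef' m, smul_zero]
  -- hence `f ≡ 0` (pointwise Fourier series of a continuous function with summable coefficients)
  have hsum : Summable (UnitAddTorus.mFourierCoeff f) := by
    have : UnitAddTorus.mFourierCoeff (⇑f) = 0 := funext hcoefT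
    rw [this]; exact summable_zero
  have hf0 : ∀ t, f t = 0 := by
    intro t
    have h := UnitAddTorus.hasSum_mFourier_series_apply_of_summable hsum t
    simp only [hcoefT, zero_smul] at h
    exact (hasSum_zero.unique h).symm ▸ rfl
  intro p
  have hp : K p = g (WithLp.toLp 2 fun k => p k / (2 * Real.pi)) := by
    simp only [hg_def]
    congr 1; funext k; field_simp
  rw [hp, show g (WithLp.toLp 2 fun k => p k / (2 * Real.pi))
      = Torus.lift (Torus.descend g hg) (WithLp.toLp 2 fun k => p k / (2 * Real.pi)) by
        rw [Torus.lift_descend_holds g hg]]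
  exact hf0 _

/-! ## §5 Poisson: the periodisation of `ȟ` vanishes when `h` vanishes on `ℤ⁴` -/

/-- **Poisson summation, uniqueness form.** Let `h` be continuous and integrable on `ℝ⁴`, with transform `ȟ` of product
decay. If `h(m) = 0` for every `m ∈ ℤ⁴`, then `Σ_{n∈ℤ⁴} ȟ(p + 2πn) = 0` for EVERY real `p`: the periodisation is
continuous and `2π`-periodic, and its `m`-th cell Fourier coefficient is `∫_{ℝ⁴} e^{−ip·m} ȟ = (2π)⁴ h(m) = 0`. (This is the
mechanism by which I (3.6)–(3.7) see only the values of position-space pairings at the lattice plaquettes.)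
[cite: SteinWeiss1971, Ch. VII §2 Thm 2.4; Federbush1986PhaseCellI, (3.6)–(3.7) p. 327] -/
theorem perSum_hatE_eq_zero {h : E4 → ℂ} {C : ℝ} (hcont : Continuous h) (hint : Integrable h)
    (hdec : HasProductDecay (hatE h) C) (hC : 0 ≤ C)
    (hzero : ∀ m : Fin 4 → ℤ, h (toE4 fun k => (m k : ℝ)) = 0) :
    ∀ p, perSum (hatE h) p = 0 := by
  have hGc : Continuous (hatE h) := continuous_hatE hint
  have hGi : Integrable (hatE h) := integrable_of_decay hdec hC hGc.aestronglyMeasurable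
  have hF : Integrable (𝓕 h) := integrable_fourier_of_integrable_hatE hGi
  refine eq_zero_of_periodic_of_coeff_zero (continuous_perSum hdec hC hGc) (perSum_shiftR (hatE h)) fun m => ?_
  rw [integral_cell_cexp_mul_perSum hGi, integral_cexp_neg_mul_hatE hcont hint hF, hzero, mul_zero]

/-! ## §6 (v1.1) ERRATUM on the majorant of `HasProductDecay`; the usable decay class `HasInvSqDecay`

`HasProductDecay G C := ∀ p, ‖G p‖ ≤ C Π_k min(1, 1/p_k²)` (§1) was meant as «bounded by `C`, and by `C/p_k²` in each
coordinate».  In Lean `1/0 = 0`, so at a momentum with some `p_k = 0` the majorant is `0` and the predicate forces `G p = 0`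
(`HasProductDecay.eq_zero_of_apply_eq_zero`): the hypothesis of `perSum_hatE_eq_zero` is then satisfiable only by transforms
vanishing on the four coordinate hyperplanes, which the intended `ȟ` (a plaquette transform I (3.10) times a test-field
transform) does not do — `P̃_a(p)` has a non-zero limit as a transverse `p_r → 0`.  Nothing false was proved (every v1
statement stands); the USABLE class is `HasInvSqDecay G C := ∀ p, ‖G p‖ ≤ C Π_k (1 + p_k²)⁻¹` (implied by the isotropic decay
`C(1 + |p|²)⁻⁴`, `HasInvSqDecay.of_isotropic`), for which the §1–§5 chain is re-proved below with the same proofs: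
`HasInvSqDecay.norm_shiftR_le`, `.summable_shiftR`, `.norm_perSum_le`, `.continuous_perSum`, `.integrable`, and
**`perSum_hatE_eq_zero_of_invSqDecay`** (Stein–Weiss VII §2 Thm 2.4, uniqueness form).  v1 declarations are unchanged
(append-only).  Unit `lit-balaban-r17` gen 12. -/

/-- ERRATUM RECORD: the v1 majorant vanishes on the coordinate hyperplanes (Lean `1/0 = 0`), so `HasProductDecay G C` forces
`G p = 0` whenever some `p_k = 0`. [cite: FederbushWilliamson1987PhaseCellII, (6.8) p. 1418] -/
theorem HasProductDecay.eq_zero_of_apply_eq_zero {G : (Fin 4 → ℝ) → ℂ} {C : ℝ} (hG : HasProductDecay G C)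
    {p : Fin 4 → ℝ} {k : Fin 4} (hk : p k = 0) : G p = 0 := by
  have h := hG p
  rw [Finset.prod_eq_zero (Finset.mem_univ k) (by rw [hk]; simp), mul_zero] at h
  exact norm_le_zero_iff.mp h

/-- **Product decay, usable form**: `|G(p)| ≤ C Π_k (1 + p_k²)⁻¹` — bounded by `C`, and by `C/p_k²` in each coordinate
separately (what a rapidly decreasing `ψ̌` times a bounded factor satisfies). [cite: FederbushWilliamson1987PhaseCellII, (6.8) p. 1418] -/
def HasInvSqDecay (G : (Fin 4 → ℝ) → ℂ) (C : ℝ) : Prop :=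
  ∀ p, ‖G p‖ ≤ C * ∏ k, (1 + (p k) ^ 2)⁻¹

/-- On the unit sup-ball about `p₀`, `(1 + (p_k + 2πn_k)²)⁻¹ ≤ 7·b(n_k + cellIndex p₀ k)` (p04's summable weight `b`).
[cite: FederbushWilliamson1987PhaseCellII, (6.8) p. 1418] -/
theorem inv_one_add_sq_shiftR_le {p₀ p : Fin 4 → ℝ} (hp : ∀ k, |p k - p₀ k| < 1) (n : Fin 4 → ℤ) (k : Fin 4) :
    (1 + (shiftR p n k) ^ 2)⁻¹ ≤ 7 * b (n k + cellIndex p₀ k) := by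
  have h1 : (1 + (shiftR p n k) ^ 2)⁻¹ ≤ 1 := inv_le_one_of_one_le₀ (by nlinarith [sq_nonneg (shiftR p n k)])
  by_cases hq : shiftR p n k = 0
  · -- then `n_k + cellIndex p₀ k = 0`: otherwise `2π ≤ 2π|N| = |reduced p₀ k + (p_k − p₀_k)| ≤ π + 1`
    set N : ℤ := n k + cellIndex p₀ k with hN
    have hN0 : N = 0 := by
      by_contra h0
      have hq' : shiftR p n k = reduced p₀ k + (p k - p₀ k) + 2 * Real.pi * (N : ℝ) := by
        simp only [shiftR, reduced, hN, Int.cast_add]; ring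
      have hN1 : (1 : ℝ) ≤ |(N : ℝ)| := by rw [← Int.cast_abs]; exact_mod_cast Int.one_le_abs h0
      have hr : |reduced p₀ k| ≤ Real.pi := abs_reduced_le p₀ k
      have hpk := (hp k).le
      have h2π : |2 * Real.pi * (N : ℝ)| = 2 * Real.pi * |(N : ℝ)| := by rw [abs_mul, abs_of_pos Real.two_pi_pos]
      have hsum : 2 * Real.pi * (N : ℝ) = -(reduced p₀ k + (p k - p₀ k)) := by rw [hq'] at hq; linarith
      have h4 : 2 * Real.pi * |(N : ℝ)| ≤ Real.pi + 1 := by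
        rw [← h2π, hsum, abs_neg]
        exact (abs_add_le _ _).trans (by linarith)
      nlinarith [Real.pi_gt_three]
    rw [hN0, b_zero]; linarith
  · have hmin : (1 + (shiftR p n k) ^ 2)⁻¹ ≤ min 1 (1 / (shiftR p n k) ^ 2) := by
      refine le_min h1 ?_
      rw [one_div]
      exact inv_anti₀ (by positivity) (by linarith)
    exact hmin.trans (min_one_inv_sq_shiftR_le hp n k)

namespace HasInvSqDecay

variable {G : (Fin 4 → ℝ) → ℂ} {C : ℝ}

/-- The constant of an inverse-square majorant is non-negative (evaluate at `p = 0`). [cite: FederbushWilliamson1987PhaseCellII, (6.8) p. 1418] -/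
theorem nonneg (hG : HasInvSqDecay G C) : 0 ≤ C := by
  have h := hG 0
  have h1 : ∏ k : Fin 4, (1 + ((0 : Fin 4 → ℝ) k) ^ 2)⁻¹ = 1 := by simp
  rw [h1, mul_one] at h
  exact (norm_nonneg _).trans h

/-- Isotropic decay `‖G p‖ ≤ C (1 + Σ_k p_k²)⁻⁴` implies the product form (each factor `(1 + p_k²)⁻¹ ≥ (1 + Σ_j p_j²)⁻¹`).
[cite: FederbushWilliamson1987PhaseCellII, (6.8) p. 1418] -/
theorem of_isotropic (hC : 0 ≤ C) (hG : ∀ p, ‖G p‖ ≤ C * ((1 + ∑ k, (p k) ^ 2) ^ 4)⁻¹) : HasInvSqDecay G C := by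
  intro p
  refine (hG p).trans (mul_le_mul_of_nonneg_left ?_ hC)
  have hS : ∀ k, (1 + ∑ j, (p j) ^ 2)⁻¹ ≤ (1 + (p k) ^ 2)⁻¹ := by
    intro k
    have hk : (p k) ^ 2 ≤ ∑ j, (p j) ^ 2 :=
      Finset.single_le_sum (f := fun j => (p j) ^ 2) (fun j _ => sq_nonneg (p j)) (Finset.mem_univ k)
    exact inv_anti₀ (by positivity) (by linarith)
  calc ((1 + ∑ k, (p k) ^ 2) ^ 4)⁻¹ = ∏ _k : Fin 4, (1 + ∑ j, (p j) ^ 2)⁻¹ := by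
        rw [Finset.prod_const, Finset.card_univ, Fintype.card_fin, inv_pow]
    _ ≤ ∏ k, (1 + (p k) ^ 2)⁻¹ := Finset.prod_le_prod (fun k _ => by positivity) fun k _ => hS k

/-- A bounded factor preserves the decay class. [cite: FederbushWilliamson1987PhaseCellII, (6.8) p. 1418] -/
theorem mul_bounded (hG : HasInvSqDecay G C) {F : (Fin 4 → ℝ) → ℂ} {B : ℝ} (hF : ∀ p, ‖F p‖ ≤ B) :
    HasInvSqDecay (fun p => F p * G p) (B * C) := by
  intro p
  rw [norm_mul, mul_assoc]
  exact mul_le_mul (hF p) (hG p) (norm_nonneg _) ((norm_nonneg _).trans (hF p))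

/-- The decay class is closed under addition. [cite: FederbushWilliamson1987PhaseCellII, (6.8) p. 1418] -/
theorem add (hG : HasInvSqDecay G C) {G' : (Fin 4 → ℝ) → ℂ} {C' : ℝ} (hG' : HasInvSqDecay G' C') :
    HasInvSqDecay (fun p => G p + G' p) (C + C') := by
  intro p
  rw [add_mul]
  exact (norm_add_le _ _).trans (add_le_add (hG p) (hG' p))

/-- The decay class is closed under finite sums. [cite: FederbushWilliamson1987PhaseCellII, (6.8) p. 1418] -/
theorem sum {ι : Type*} (s : Finset ι) {Gf : ι → (Fin 4 → ℝ) → ℂ} {Cf : ι → ℝ} (h : ∀ i ∈ s, HasInvSqDecay (Gf i) (Cf i)) :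
    HasInvSqDecay (fun p => ∑ i ∈ s, Gf i p) (∑ i ∈ s, Cf i) := by
  intro p
  rw [Finset.sum_mul]
  exact (norm_sum_le _ _).trans (Finset.sum_le_sum fun i hi => h i hi p)

/-- On the unit sup-ball about `p₀` the terms of the periodisation have the summable majorant `C·7⁴·u(n + cellIndex p₀)`.
[cite: FederbushWilliamson1987PhaseCellII, (6.8) p. 1418] -/
theorem norm_shiftR_le (hG : HasInvSqDecay G C) {p₀ p : Fin 4 → ℝ} (hp : ∀ k, |p k - p₀ k| < 1) (n : Fin 4 → ℤ) :
    ‖G (shiftR p n)‖ ≤ C * 7 ^ 4 * u (n + cellIndex p₀) := by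
  refine (hG _).trans ?_
  have h : ∏ k, (1 + (shiftR p n k) ^ 2)⁻¹ ≤ ∏ k, 7 * b (n k + cellIndex p₀ k) :=
    Finset.prod_le_prod (fun k _ => by positivity) fun k _ => inv_one_add_sq_shiftR_le hp n k
  rw [Finset.prod_mul_distrib, Finset.prod_const, Finset.card_univ, Fintype.card_fin] at h
  calc C * ∏ k, (1 + (shiftR p n k) ^ 2)⁻¹ ≤ C * (7 ^ 4 * ∏ k, b (n k + cellIndex p₀ k)) :=
        mul_le_mul_of_nonneg_left h hG.nonneg
    _ = C * 7 ^ 4 * u (n + cellIndex p₀) := by simp only [u, Pi.add_apply]; ring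

/-- The periodisation of a function of the decay class converges absolutely at every point.
[cite: FederbushWilliamson1987PhaseCellII, (1.4) p. 1416, (6.8) p. 1418] -/
theorem summable_shiftR (hG : HasInvSqDecay G C) (p : Fin 4 → ℝ) : Summable fun n : Fin 4 → ℤ => G (shiftR p n) :=
  Summable.of_norm_bounded ((summable_u_shift (cellIndex p)).mul_left (C * 7 ^ 4))
    (fun n => hG.norm_shiftR_le (p₀ := p) (fun k => by simp) n)

/-- The periodisation is bounded, uniformly. [cite: FederbushWilliamson1987PhaseCellII, (1.4) p. 1416, (6.8) p. 1418] -/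
theorem norm_perSum_le (hG : HasInvSqDecay G C) (p : Fin 4 → ℝ) : ‖perSum G p‖ ≤ C * 7 ^ 4 * ∑' n, u n := by
  unfold perSum
  refine (norm_tsum_le_tsum_norm (hG.summable_shiftR p).norm).trans ?_
  calc ∑' n, ‖G (shiftR p n)‖ ≤ ∑' n, C * 7 ^ 4 * u (n + cellIndex p) :=
        (hG.summable_shiftR p).norm.tsum_le_tsum (fun n => hG.norm_shiftR_le (p₀ := p) (fun k => by simp) n)
          ((summable_u_shift (cellIndex p)).mul_left _)
    _ = C * 7 ^ 4 * ∑' n, u n := by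
        rw [tsum_mul_left]
        congr 1
        exact (Equiv.addRight (cellIndex p)).tsum_eq u

/-- **The periodisation of a continuous function of the decay class is continuous** (uniform convergence on unit balls).
[cite: FederbushWilliamson1987PhaseCellII, (1.4) p. 1416, (3.1) p. 1417] -/
theorem continuous_perSum (hG : HasInvSqDecay G C) (hcont : Continuous G) : Continuous (perSum G) := by
  rw [continuous_iff_continuousAt]
  intro p₀
  have hball : ∀ p ∈ Metric.ball p₀ 1, ∀ k, |p k - p₀ k| < 1 := by
    intro p hp k
    have := (dist_pi_lt_iff one_pos).mp (Metric.mem_ball.mp hp) k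
    rwa [Real.dist_eq] at this
  have hon : ContinuousOn (perSum G) (Metric.ball p₀ 1) := by
    unfold perSum
    refine continuousOn_tsum (fun n => ?_) ((summable_u_shift (cellIndex p₀)).mul_left (C * 7 ^ 4))
      (fun n p hp => hG.norm_shiftR_le (hball p hp) n)
    have : Continuous fun p : Fin 4 → ℝ => shiftR p n :=
      continuous_pi fun k => (continuous_apply k).add continuous_const
    exact (hcont.comp this).continuousOn
  exact hon.continuousAt (Metric.isOpen_ball.mem_nhds (Metric.mem_ball_self one_pos))

/-- A function of the decay class is integrable on `ℝ⁴` (given measurability): majorant `C Π_k (1 + p_k²)⁻¹`.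
[cite: FederbushWilliamson1987PhaseCellII, (6.8) p. 1418] -/
theorem integrable (hG : HasInvSqDecay G C) (hmeas : AEStronglyMeasurable G volume) : Integrable G := by
  have h1 : Integrable (fun t : ℝ => (1 + t ^ 2)⁻¹) := integrable_inv_one_add_sq
  have hprod : Integrable (fun p : Fin 4 → ℝ => ∏ k, (1 + (p k) ^ 2)⁻¹) := by
    have := Integrable.fintype_prod (ι := Fin 4) (μ := fun _ => (volume : Measure ℝ)) (fun _ => h1)
    rwa [← MeasureTheory.volume_pi] at this
  exact Integrable.mono' (hprod.const_mul C) hmeas (ae_of_all _ fun p => hG p)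

end HasInvSqDecay

/-- **Poisson summation, uniqueness form (usable hypothesis).** Let `h` be continuous and integrable on `ℝ⁴`, with transform
`ȟ` of inverse-square product decay `|ȟ(p)| ≤ C Π_k (1 + p_k²)⁻¹`. If `h(m) = 0` for every `m ∈ ℤ⁴`, then `Σ_{n∈ℤ⁴} ȟ(p + 2πn) = 0`
for EVERY real `p` (the periodisation is continuous and `2π`-periodic, with `m`-th cell Fourier coefficient `(2π)⁴ h(m) = 0`).
[cite: SteinWeiss1971, Ch. VII §2 Thm 2.4; Federbush1986PhaseCellI, (3.6)–(3.7) p. 327] -/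
theorem perSum_hatE_eq_zero_of_invSqDecay {h : E4 → ℂ} {C : ℝ} (hcont : Continuous h) (hint : Integrable h)
    (hdec : HasInvSqDecay (hatE h) C) (hzero : ∀ m : Fin 4 → ℤ, h (toE4 fun k => (m k : ℝ)) = 0) :
    ∀ p, perSum (hatE h) p = 0 := by
  have hGc : Continuous (hatE h) := continuous_hatE hint
  have hGi : Integrable (hatE h) := hdec.integrable hGc.aestronglyMeasurable
  have hF : Integrable (𝓕 h) := integrable_fourier_of_integrable_hatE hGi
  refine eq_zero_of_periodic_of_coeff_zero (hdec.continuous_perSum hGc) (perSum_shiftR (hatE h)) fun m => ?_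
  rw [integral_cell_cexp_mul_perSum hGi, integral_cexp_neg_mul_hatE hcont hint hF, hzero, mul_zero]

end PlaquetteGram

end

end Literature.MathematicalPhysics.QuantumFieldTheory.Federbush1986
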